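/-
Copyright (c) 2026. All rights reserved.
Released under Apache 2.0 license as described in the file LICENSE.
Authors: abc-iut cell, wave-3 discharge seat abc-iut-L6-d2 (gen 2) (the real `GaloisPadicLog` of
abc-iut-L4-t2, [AbsTopIII] Def 3.1 (i)/(iv), for EVERY `MLFClosure`: an arbitrary MLF `k` with an
arbitrary algebraic closure `k̄`).
-/
import Literature.AnabelianGeometry.AbsoluteAnabelian.GaloisPadicLogTower
import Literature.AnabelianGeometry.AbsoluteAnabelian.MLFClosureUnitsInfinitelyDivisible
import Literature.AnabelianGeometry.AbsoluteAnabelian.AbsTopIII.PadicEmbeddingRigidity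
import Literature.NumberTheory.PAdicHodge.PadicBaseField
import Literature.AnabelianGeometry.AbsoluteAnabelian.MLFGaloisPairs
import Literature.AnabelianGeometry.AbsoluteAnabelian.GaloisPadicLogPerfection
import HarnessLib

/-!
# [AbsTopIII] Def 3.1 (i): the real `log_k̄` for EVERY MLF `k` and EVERY algebraic closure `k̄`

S. Mochizuki, *Topics in absolute anabelian geometry III*, J. Math. Sci. Univ. Tokyo 22 (2015)
[MochizukiAbsTopIII2015], Def 3.1 (i), manuscript p. 66 l. 21–27: "Note that the [`p`-adic, if `k` is
of residue characteristic `p`] logarithm determines a `Π_k`-equivariant isomorphism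
`log_k̄ : k~ := (𝒪_k̄^×)^pf ⥲ k̄` [where “pf” denotes the perfection …] of the topological group `k~` onto
the additive topological group `k̄`" (used by the log-Frobenius operation of Def 3.1 (iv), pp. 68–69;
paraphrase: this is the codomain `log(†F_v)` of the log-link of [IUTchIII] Def 1.1 (i) at every
`v ∈ V^non`, with `k = K_v` an arbitrary completion of a number field).

abc-iut-L4-t2 typed the pair `(k, k̄)` as the container `MLFClosure` (an MLF `k` — Mathlib
`IsNonarchimedeanLocalField k` + `CharZero k` — with an abstract algebraic closure `K`,
`IsAlgClosure k K`) and `log_k̄` as the HYPOTHESIS STRUCTURE `GaloisPadicLog k K`; every L4 consumer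
carries `(L : GaloisPadicLog C.k C.K)`. abc-iut-L3-t11 inhabited it for the ℚ_p-model
(`MLFClosure.padic`); `GaloisPadicLogTower.lean` (this seat) for every base inside `ℚ̄_p` whose
valuation ring is the pull-back of the unit ball. THIS FILE inhabits it for EVERY `C : MLFClosure.{0}`:

  `MLFClosure.galoisPadicLog C : GaloisPadicLog C.k C.K`,  `MLFClosure.nonempty_galoisPadicLog C`.

Construction (classical; Serre *Local Fields* II §5, Neukirch ANT II (5.2), (4.8)):
1. `p :=` the residue characteristic of `k`; `ℚ_p → k` is the tree's canonical `LocalField.padicAlgebra`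
   (`GaloisRepresentations/PadicAlgebraOfLocalField`), `[k : ℚ_p] < ∞` is the tree's
   `PadicBase.instFiniteDimensional` (`PAdicHodge/PadicBaseField`); hence `K = k̄` is an algebraic
   closure of `ℚ_p`, and `e : K ≃ₐ[ℚ_p] ℚ̄_p` (Mathlib `IsAlgClosure.equiv`, `ℚ̄_p = PadicAlgCl p`).
2. Along `k → K ≃ ℚ̄_p` the base `k` sits inside `ℚ̄_p`; the one input of
   `GaloisPadicLog.ofPadicTowerUnits` — `𝒪_k̄^× (over k) = {‖x‖ = 1}` in `ℚ̄_p` — is PROVED for an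
   abstract MLF base WITHOUT comparing absolute values on `k`, through the divisibility
   characterisation of units: `x ∈ 𝒪_k̄^×` iff `x` has `ℓ^n`-th roots in `k(x)` for all `n`, for some
   prime `ℓ` (abc-iut-L6-t11's [AbsTopIII] Rmk 3.1.1 theorem
   `mem_unitSubmonoid_iff_exists_prime_forall_exists_pow_eq`, over `k` AND over `ℚ_p`), and such
   elements have norm `1` in the finite extension `k(x) ⊆ ℚ̄_p` of `ℚ_p` (the tree's rigidity lemma
   `spectralNorm_eq_one_of_forall_exists_pow_prime_pow_eq`, `AbsTopIII/PadicEmbeddingRigidity`)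
   — `mem_unitSubmonoid_iff_norm_eq_one_of_isNonarchimedeanLocalField`.
3. `GaloisPadicLog.comap` transports a `GaloisPadicLog k K'` along any `k`-algebra isomorphism
   `K ≃ₐ[k] K'` (pure algebra: `𝒪[k]`-integrality is preserved), and `e` is a `k`-isomorphism for the
   induced `k`-structure on `ℚ̄_p`.

Consequence: the hypothesis `(L : GaloisPadicLog C.k C.K)` of abc-iut-L4-t2's Def 3.1 (i)/(iv) files
(`LogFrobeniusOutput`, pre-log-shells) is dischargeable for every `C` (universe `0`, which is where
`ℚ̄_p` lives; `MLFClosure.padic` is universe `0`). HONEST FRAMING: classical `p`-adic analysis; the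
`def`s are the transported logarithm and the instance; nothing here bears on [IUTchIII] Cor. 3.12;
typed ≠ discharged.
-/

set_option autoImplicit false

noncomputable section

namespace Literature.AnabelianGeometry.AbsoluteAnabelian

open Polynomial ValuativeRel
open scoped ValuativeRel
open Literature.NumberTheory.Transcendental
open Literature.NumberTheory.GaloisRepresentations

universe u

/-! ## Transport of a `GaloisPadicLog` along a `k`-isomorphism of the closures -/

section Comap

variable {k : Type u} [Field k] [ValuativeRel k] {K K' : Type u} [Field K] [Field K']
  [Algebra k K] [Algebra k K']

/-- A `k`-algebra isomorphism `K ≃ₐ[k] K'` preserves `𝒪_k̄`: integrality over `𝒪_k` is transported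
(restriction of scalars of `e` to `𝒪_k`). [cite: MochizukiAbsTopIII2015, Definition 3.1 (i) p.66] -/
theorem mem_integersClosure_algEquiv_iff (e : K ≃ₐ[k] K') (x : K) :
    e x ∈ integersClosure k K' ↔ x ∈ integersClosure k K := by
  rw [integersClosure, integersClosure, mem_integralClosure_iff, mem_integralClosure_iff]
  exact isIntegral_algEquiv (e.restrictScalars 𝒪[k])

/-- A `k`-algebra isomorphism `K ≃ₐ[k] K'` preserves `𝒪_k̄^×`. [cite: MochizukiAbsTopIII2015, Definition 3.1 (i) p.66] -/
theorem mem_unitSubmonoid_algEquiv_iff (e : K ≃ₐ[k] K') (x : K) :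
    e x ∈ unitSubmonoid k K' ↔ x ∈ unitSubmonoid k K := by
  constructor
  · rintro ⟨hx, y, hy, hxy⟩
    refine ⟨(mem_integersClosure_algEquiv_iff e x).mp hx, e.symm y,
      (mem_integersClosure_algEquiv_iff e _).mp (by rw [AlgEquiv.apply_symm_apply]; exact hy), ?_⟩
    apply e.injective
    rw [map_mul, AlgEquiv.apply_symm_apply, hxy, map_one]
  · rintro ⟨hx, y, hy, hxy⟩
    exact ⟨(mem_integersClosure_algEquiv_iff e x).mpr hx, e y,
      (mem_integersClosure_algEquiv_iff e y).mpr hy, by rw [← map_mul, hxy, map_one]⟩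

/-- **Transport of `log_k̄` along a `k`-isomorphism of algebraic closures**: if `K'` carries a
`GaloisPadicLog k K'` and `e : K ≃ₐ[k] K'`, then `x ↦ e⁻¹ (log (e x))` is a `GaloisPadicLog k K`
(homomorphism on `𝒪_k̄^×`, `Gal(K/k)`-equivariant via `σ ↦ e σ e⁻¹`, kernel the roots of unity, onto).
[cite: MochizukiAbsTopIII2015, Definition 3.1 (i) p.66] -/
def GaloisPadicLog.comap (e : K ≃ₐ[k] K') (L : GaloisPadicLog k K') : GaloisPadicLog k K where
  log x := e.symm (L.log (e x))
  log_mul x hx y hy := by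
    rw [map_mul, L.log_mul _ ((mem_unitSubmonoid_algEquiv_iff e x).mpr hx) _
      ((mem_unitSubmonoid_algEquiv_iff e y).mpr hy), map_add]
  log_smul σ x hx := by
    have h := L.log_smul (e.symm.trans (σ.trans e)) (e x) ((mem_unitSubmonoid_algEquiv_iff e x).mpr hx)
    rw [AlgEquiv.smul_def, AlgEquiv.smul_def, AlgEquiv.trans_apply, AlgEquiv.trans_apply,
      AlgEquiv.symm_apply_apply] at h
    rw [AlgEquiv.smul_def, AlgEquiv.smul_def, h, AlgEquiv.trans_apply, AlgEquiv.trans_apply,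
      AlgEquiv.symm_apply_apply]
  log_eq_zero_iff x hx := by
    rw [map_eq_zero_iff _ e.symm.injective,
      L.log_eq_zero_iff _ ((mem_unitSubmonoid_algEquiv_iff e x).mpr hx)]
    refine exists_congr fun n => and_congr_right fun _ => ?_
    rw [← map_pow, ← map_eq_one_iff _ e.injective]
  log_surjective y := by
    obtain ⟨x', hx', hy⟩ := L.log_surjective (e y)
    refine ⟨e.symm x', (mem_unitSubmonoid_algEquiv_iff e _).mp (by rwa [AlgEquiv.apply_symm_apply]), ?_⟩
    rw [AlgEquiv.apply_symm_apply, hy, AlgEquiv.symm_apply_apply]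

/-- Unfolding lemma for the transported logarithm. [cite: MochizukiAbsTopIII2015, Definition 3.1 (i) p.66] -/
@[simp] theorem GaloisPadicLog.comap_log (e : K ≃ₐ[k] K') (L : GaloisPadicLog k K') (x : K) :
    (L.comap e).log x = e.symm (L.log (e x)) := rfl

end Comap

/-! ## An abstract MLF base embedded in `ℚ̄_p`: `𝒪_k̄^× = {‖x‖ = 1}` via infinite divisibility -/

section EmbeddedMLF

variable (p : ℕ) [hp : Fact p.Prime]
variable {k : Type} [Field k] [ValuativeRel k] [TopologicalSpace k] [IsNonarchimedeanLocalField k]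
  [Algebra ℚ_[p] k] [FiniteDimensional ℚ_[p] k] [Algebra k (PadicAlgCl p)]
  [IsScalarTower ℚ_[p] k (PadicAlgCl p)]

omit [ValuativeRel k] [TopologicalSpace k] [IsNonarchimedeanLocalField k] [FiniteDimensional ℚ_[p] k] in
/-- `ℚ̄_p` is algebraic over any intermediate base `k`. [cite: MochizukiAbsTopIII2015, Definition 3.1 (i) p.66] -/
theorem PadicAlgCl.isAlgebraic_of_tower : Algebra.IsAlgebraic k (PadicAlgCl p) :=
  Algebra.IsAlgebraic.tower_top (K := ℚ_[p]) k

omit [ValuativeRel k] [TopologicalSpace k] [IsNonarchimedeanLocalField k] in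
/-- An element of `ℚ̄_p` which, for some prime `ℓ`, has `ℓ^n`-th roots in `k(x)` for every `n`
(where `k ⊆ ℚ̄_p` is finite over `ℚ_p`) has norm `1`: `k(x)` is a finite extension of `ℚ_p`, in which
such elements have spectral norm `1` (tree: `PadicEmbeddingRigidity`), and the spectral norm of
`k(x)/ℚ_p` is the restriction of that of `ℚ̄_p`. [cite: MochizukiAbsTopIII2015, Remark 3.1.1 p.70] -/
theorem PadicAlgCl.norm_eq_one_of_forall_exists_pow_eq_adjoin {x : PadicAlgCl p} (hx : x ≠ 0)
    {ℓ : ℕ} (hℓ : ℓ.Prime)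
    (hdiv : ∀ n : ℕ, ∃ y : PadicAlgCl p,
      y ∈ IntermediateField.adjoin k ({x} : Set (PadicAlgCl p)) ∧ y ^ (ℓ ^ n) = x) :
    ‖x‖ = 1 := by
  haveI : Algebra.IsAlgebraic k (PadicAlgCl p) := PadicAlgCl.isAlgebraic_of_tower p
  set F := IntermediateField.adjoin k ({x} : Set (PadicAlgCl p)) with hF
  have hxk : IsIntegral k x := (Algebra.IsAlgebraic.isAlgebraic x).isIntegral
  haveI : FiniteDimensional k F := IntermediateField.adjoin.finiteDimensional hxk
  haveI : FiniteDimensional ℚ_[p] F := Module.Finite.trans k F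
  haveI : IsScalarTower ℚ_[p] F (PadicAlgCl p) := IsScalarTower.of_algebraMap_eq fun _ => rfl
  set x' : F := IntermediateField.AdjoinSimple.gen k x with hx'
  have hx'0 : x' ≠ 0 := fun h => hx (by
    have := congrArg (fun z : F => (z : PadicAlgCl p)) h
    simpa [hx'] using this)
  have hdiv' : ∀ n : ℕ, ∃ y : F, y ^ (ℓ ^ n) = x' := fun n => by
    obtain ⟨y, hyF, hy⟩ := hdiv n
    exact ⟨⟨y, hyF⟩, Subtype.ext (by simpa [hx'] using hy)⟩
  have h1 := AbsTopIII.spectralNorm_eq_one_of_forall_exists_pow_prime_pow_eq p F hℓ x' hx'0 hdiv'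
  rw [spectralNorm.eq_of_tower (K := ℚ_[p]) (L := PadicAlgCl p) x', PadicAlgCl.spectralNorm_eq] at h1
  simpa [hx'] using h1

/-- **`𝒪_k̄^× = {‖x‖ = 1}` for an abstract MLF base `k ⊆ ℚ̄_p`** (finite over `ℚ_p`, with its own
valuative structure of a non-archimedean local field), with NO comparison of absolute values: both
sides are characterised by infinite `ℓ`-divisibility in `k(x)` resp. `ℚ_p(x) ⊆ k(x)`
(abc-iut-L6-t11's [AbsTopIII] Rmk 3.1.1 theorem over `k` and over `ℚ_p`, abc-iut-L3-t11's
`𝒪_{ℚ̄_p}^× = {‖x‖ = 1}` over `ℚ_p`, and the rigidity lemma above).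
[cite: MochizukiAbsTopIII2015, Definition 3.1 (i) p.66] -/
theorem mem_unitSubmonoid_iff_norm_eq_one_of_isNonarchimedeanLocalField (x : PadicAlgCl p) :
    x ∈ unitSubmonoid k (PadicAlgCl p) ↔ ‖x‖ = 1 := by
  haveI : Algebra.IsAlgebraic k (PadicAlgCl p) := PadicAlgCl.isAlgebraic_of_tower p
  rcases eq_or_ne x 0 with rfl | hx0
  · constructor
    · intro h
      exact absurd rfl (unitSubmonoid_le_nonzeroIntegers h).2
    · intro h
      rw [norm_zero] at h
      exact absurd h zero_ne_one
  constructor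
  · intro hx
    obtain ⟨ℓ, hℓ, hdiv⟩ :=
      (mem_unitSubmonoid_iff_exists_prime_forall_exists_pow_eq k (PadicAlgCl p) hx0).mp hx
    exact PadicAlgCl.norm_eq_one_of_forall_exists_pow_eq_adjoin p hx0 hℓ hdiv
  · intro hx
    -- over `ℚ_p`: `x ∈ 𝒪_{ℚ̄_p}^×`, hence `ℓ^∞`-divisible in `ℚ_p(x) ⊆ k(x)`
    have hxQ : x ∈ unitSubmonoid ℚ_[p] (PadicAlgCl p) := (PadicAlgCl.mem_unitSubmonoid_iff x).mpr hx
    have hQ := (MLFClosure.padic p).mem_unitSubmonoid_iff_exists_prime_forall_exists_pow_eq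
      (x := (x : (MLFClosure.padic p).K)) hx0
    obtain ⟨ℓ, hℓ, hdiv⟩ := hQ.mp hxQ
    refine (mem_unitSubmonoid_iff_exists_prime_forall_exists_pow_eq k (PadicAlgCl p) hx0).mpr
      ⟨ℓ, hℓ, fun n => ?_⟩
    obtain ⟨y, hyQ, hy⟩ := hdiv n
    refine ⟨y, ?_, hy⟩
    have hle : IntermediateField.adjoin ℚ_[p] ({x} : Set (PadicAlgCl p)) ≤
        (IntermediateField.adjoin k ({x} : Set (PadicAlgCl p))).restrictScalars ℚ_[p] :=
      IntermediateField.adjoin_le_iff.mpr (Set.singleton_subset_iff.mpr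
        (IntermediateField.subset_adjoin k ({x} : Set (PadicAlgCl p)) (Set.mem_singleton x)))
    exact hle hyQ

/-- Hence `𝒪_k̄^×` over the MLF base `k ⊆ ℚ̄_p` is the same submonoid of `ℚ̄_p` as over `ℚ_p`.
[cite: MochizukiAbsTopIII2015, Definition 3.1 (i) p.66] -/
theorem unitSubmonoid_eq_of_isNonarchimedeanLocalField :
    unitSubmonoid k (PadicAlgCl p) = unitSubmonoid ℚ_[p] (PadicAlgCl p) := by
  ext x
  rw [mem_unitSubmonoid_iff_norm_eq_one_of_isNonarchimedeanLocalField p, PadicAlgCl.mem_unitSubmonoid_iff]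

/-- **The real `log_k̄` over an abstract MLF base `k ⊆ ℚ̄_p`** (finite over `ℚ_p`, any non-archimedean
local field structure): `GaloisPadicLog k ℚ̄_p` with `log := padicLogAlgCl p`.
[cite: MochizukiAbsTopIII2015, Definition 3.1 (i) p.66] -/
def GaloisPadicLog.ofEmbeddedMLF : GaloisPadicLog k (PadicAlgCl p) :=
  GaloisPadicLog.ofPadicTowerUnits p (unitSubmonoid_eq_of_isNonarchimedeanLocalField p)

/-- The logarithm of `GaloisPadicLog.ofEmbeddedMLF` is the tree's `padicLogAlgCl`.
[cite: MochizukiAbsTopIII2015, Definition 3.1 (i) p.66] -/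
@[simp] theorem GaloisPadicLog.ofEmbeddedMLF_log :
    (GaloisPadicLog.ofEmbeddedMLF p (k := k)).log = padicLogAlgCl p := rfl

end EmbeddedMLF

/-! ## Every `MLFClosure` -/

namespace MLFClosure

variable (C : MLFClosure.{0}) (p : ℕ) [hp : Fact p.Prime]

/-- `k̄` is algebraic over `ℚ_p` along `ℚ_p → k → k̄`, `k` being finite over `ℚ_p`
(tree `PadicBase.instFiniteDimensional`) and `k̄` algebraic over `k`.
[cite: MochizukiAbsTopIII2015, Definition 3.1 (i) p.66] -/
theorem isAlgebraic_padic_K (hpk : valuation C.k p < 1) :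
    letI : Algebra ℚ_[p] C.k := LocalField.padicAlgebra C.k p hpk
    letI : Algebra ℚ_[p] C.K := ((algebraMap C.k C.K).comp (LocalField.padicRingHom C.k p hpk)).toAlgebra
    Algebra.IsAlgebraic ℚ_[p] C.K := by
  letI : Algebra ℚ_[p] C.k := LocalField.padicAlgebra C.k p hpk
  letI : Algebra ℚ_[p] C.K := ((algebraMap C.k C.K).comp (LocalField.padicRingHom C.k p hpk)).toAlgebra
  haveI : IsScalarTower ℚ_[p] C.k C.K := IsScalarTower.of_algebraMap_eq fun _ => rfl
  haveI : FiniteDimensional ℚ_[p] C.k :=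
    Literature.NumberTheory.PAdicHodge.PadicBase.instFiniteDimensional (F := C.k) (p := p) hpk
  haveI : Algebra.IsAlgebraic ℚ_[p] C.k := Algebra.IsAlgebraic.of_finite ℚ_[p] C.k
  haveI : Algebra.IsAlgebraic C.k C.K := IsAlgClosure.isAlgebraic
  exact Algebra.IsAlgebraic.trans ℚ_[p] C.k C.K

/-- **The real `log_k̄` of an arbitrary `MLFClosure`, at a residue characteristic `p`**
(`valuation k p < 1`): transport of `padicLogAlgCl p` along `k̄ ≃ₐ[ℚ_p] ℚ̄_p`.
[cite: MochizukiAbsTopIII2015, Definition 3.1 (i) p.66] -/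
def galoisPadicLogOfResidueChar (hpk : valuation C.k p < 1) : GaloisPadicLog C.k C.K :=
  letI iQk : Algebra ℚ_[p] C.k := LocalField.padicAlgebra C.k p hpk
  letI iQK : Algebra ℚ_[p] C.K := ((algebraMap C.k C.K).comp (LocalField.padicRingHom C.k p hpk)).toAlgebra
  haveI : IsScalarTower ℚ_[p] C.k C.K := IsScalarTower.of_algebraMap_eq fun _ => rfl
  haveI : FiniteDimensional ℚ_[p] C.k :=
    Literature.NumberTheory.PAdicHodge.PadicBase.instFiniteDimensional (F := C.k) (p := p) hpk
  haveI : IsAlgClosure ℚ_[p] C.K :=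
    { isAlgClosed := IsAlgClosure.isAlgClosed C.k
      isAlgebraic := C.isAlgebraic_padic_K p hpk }
  let e : C.K ≃ₐ[ℚ_[p]] PadicAlgCl p := IsAlgClosure.equiv ℚ_[p] C.K (PadicAlgCl p)
  letI ikA : Algebra C.k (PadicAlgCl p) := (e.toAlgHom.toRingHom.comp (algebraMap C.k C.K)).toAlgebra
  haveI : IsScalarTower ℚ_[p] C.k (PadicAlgCl p) := IsScalarTower.of_algebraMap_eq fun c => by
    change algebraMap ℚ_[p] (PadicAlgCl p) c = e (algebraMap C.k C.K (algebraMap ℚ_[p] C.k c))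
    rw [← IsScalarTower.algebraMap_apply ℚ_[p] C.k C.K, AlgEquiv.commutes]
  let e' : C.K ≃ₐ[C.k] PadicAlgCl p :=
    { e.toRingEquiv with commutes' := fun _ => rfl }
  (GaloisPadicLog.ofEmbeddedMLF p (k := C.k)).comap e'

/-- The residue characteristic `char 𝓀[k]` of the MLF `k` is a prime.
[cite: MochizukiAbsTopIII2015, Definition 3.1 (i) p.66] -/
theorem ringChar_residueField_prime : (ringChar 𝓀[C.k]).Prime :=
  CharP.char_is_prime 𝓀[C.k] _

/-- The residue characteristic has valuation `< 1` in `k` (it vanishes in `𝓀[k]`, i.e. lies in `𝓂_k`).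
[cite: MochizukiAbsTopIII2015, Definition 3.1 (i) p.66] -/
theorem valuation_ringChar_lt_one : valuation C.k (ringChar 𝓀[C.k]) < 1 := by
  have hmem : ((ringChar 𝓀[C.k] : ℕ) : 𝒪[C.k]) ∈ 𝓂[C.k] := by
    rw [← IsLocalRing.residue_eq_zero_iff, map_natCast]
    exact CharP.cast_eq_zero 𝓀[C.k] (ringChar 𝓀[C.k])
  have h : valuation C.k (((ringChar 𝓀[C.k] : ℕ) : 𝒪[C.k]) : C.k) < 1 :=
    Valuation.Integer.not_isUnit_iff_valuation_lt_one.mp ((IsLocalRing.mem_maximalIdeal _).mp hmem)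
  simpa using h

/-- **[AbsTopIII] Def 3.1 (i) (`log_k̄`) for EVERY `MLFClosure`**: every MLF `k` with any algebraic closure `k̄`
carries the real `p`-adic logarithm `log_k̄` as a `GaloisPadicLog k k̄` — homomorphism on `𝒪_k̄^×`,
`G_k`-equivariant, kernel exactly the roots of unity, onto `k̄` — with NO hypothesis.
[cite: MochizukiAbsTopIII2015, Definition 3.1 (i) p.66] -/
def galoisPadicLog : GaloisPadicLog C.k C.K :=
  haveI : Fact (ringChar 𝓀[C.k]).Prime := ⟨C.ringChar_residueField_prime⟩
  C.galoisPadicLogOfResidueChar (ringChar 𝓀[C.k]) C.valuation_ringChar_lt_one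

/-- Non-vacuity of abc-iut-L4-t2's Def 3.1 container WITH its logarithm, for every `MLFClosure`
(universe `0`): the hypothesis `(L : GaloisPadicLog C.k C.K)` is always dischargeable.
[cite: MochizukiAbsTopIII2015, Definition 3.1 (i) p.66] -/
theorem nonempty_galoisPadicLog : Nonempty (GaloisPadicLog C.k C.K) := ⟨C.galoisPadicLog⟩

/-- In particular abc-iut-L4-t2's `LogFrobeniusOutput` (the output `(Π_k ↷ k~)` of the
log-Frobenius operation with its pre-log-shell, [AbsTopIII] Def 3.1 (iv)) exists for every model
datum `ModelMLFGaloisData` over every `MLFClosure`. [cite: MochizukiAbsTopIII2015, Definition 3.1 (iv) pp.68–69] -/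
theorem nonempty_logFrobeniusOutput (D : ModelMLFGaloisData C.k C.K) :
    Nonempty (LogFrobeniusOutput C.k C.K) :=
  haveI : Algebra.IsAlgebraic C.k C.K := IsAlgClosure.isAlgebraic
  ⟨{ data := D, log := C.galoisPadicLog }⟩

/-! ### `log_k̄ : k~ ⥲ k̄` as an isomorphism, for every `MLFClosure` (appended) -/

/-- **[AbsTopIII] Def 3.1 (i) for every `MLFClosure`, as a kernel ISOMORPHISM**: for an arbitrary MLF `k`
with arbitrary algebraic closure `k̄`, the real logarithm `MLFClosure.galoisPadicLog` induces
`log_k̄ : k~ := 𝒪_k̄^× ⧸ 𝒪_k̄^μ ≃* (k̄, +)` (`GaloisPadicLog.logEquiv` of `GaloisPadicLogPerfection.lean`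
at the instance of this file). [cite: MochizukiAbsTopIII2015, Definition 3.1 (i) p.66] -/
def logEquiv : unitGroup C.k C.K ⧸ CommGroup.torsion (unitGroup C.k C.K) ≃* Multiplicative C.K :=
  C.galoisPadicLog.logEquiv

/-- `log_k̄` on the class of a unit `u ∈ 𝒪_k̄^×` is the (transported Iwasawa) logarithm of `u`.
[cite: MochizukiAbsTopIII2015, Definition 3.1 (i) p.66] -/
@[simp] theorem logEquiv_mk (u : unitGroup C.k C.K) :
    C.logEquiv (QuotientGroup.mk u) = Multiplicative.ofAdd (C.galoisPadicLog.log ((u : (C.K)ˣ) : C.K)) :=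
  rfl

/-- **`Π_k`-equivariance of `log_k̄ : k~ ⥲ k̄`** for every `MLFClosure`: `log_k̄ [σ u] = σ (log_k̄ [u])` for
`σ ∈ G_k = Gal(k̄/k)` (hence for `Π_k ↠ G_k`). [cite: MochizukiAbsTopIII2015, Definition 3.1 (i) p.66] -/
theorem logEquiv_map_galois (σ : C.K ≃ₐ[C.k] C.K) (u : unitGroup C.k C.K) :
    C.logEquiv (QuotientGroup.mk ⟨Units.map (σ : C.K →* C.K) (u : (C.K)ˣ), unitGroup_map_galois_mem σ u.2⟩) =
      Multiplicative.ofAdd (σ (Multiplicative.toAdd (C.logEquiv (QuotientGroup.mk u)))) :=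
  C.galoisPadicLog.logEquiv_map_galois σ u

/-- **`k~ = 𝒪_k̄^× ⧸ 𝒪_k̄^μ` is perfect** for every `MLFClosure`: every `n`-th power map, `n ≥ 1`, is
bijective on it (so the quotient by the roots of unity is the perfection `(𝒪_k̄^×)^pf` of the text).
[cite: MochizukiAbsTopIII2015, Definition 3.1 (i) p.66] -/
theorem pow_bijective_unitsModTorsion {n : ℕ} (hn : 0 < n) :
    Function.Bijective fun x : unitGroup C.k C.K ⧸ CommGroup.torsion (unitGroup C.k C.K) => x ^ n :=
  -- `k̄` has characteristic `0` (it contains the MLF `k`); the named form of this fact is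
  -- abc-iut-L6-d1's `MLFClosure.charZero_K` (AbsTopIII/EquivariantSignRigidity.lean), not re-declared here.
  haveI : CharZero C.K := charZero_of_injective_algebraMap (algebraMap C.k C.K).injective
  C.galoisPadicLog.pow_bijective_unitsModTorsion hn

end MLFClosure

end Literature.AnabelianGeometry.AbsoluteAnabelian

end
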